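import Summits.FinalStateConjecture.FinalStateConjecture.Theorems.SwallowTheDatumBurialIntoShieldedBackground
import Summits.FinalStateConjecture.FinalStateConjecture.Theorems.PhaseMixingCaptureCaptureSufficesStubDilationThread
import Literature.Geometry.Lorentzian.AFEndDilationDecay

/-!
# Route `SwallowTheDatum` · item `BurialIntoShieldedBackground` (stmt-FinalStateConjecture-14721) —
# the RELATIVE BURIAL OF THE FLAT DATUM

The item reads `KerrShieldedDataExist → ParametricKerrBurial`: given ONE admissible Kerr-shielded background `B`
on `ℝ³`, every admissible datum `d` on every `X` is parametrically Kerr-buried.  For a general `d` this is the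
parametric gluing engine of the crux (Hintz 2022, Mao–Oh–Tao 2023), absent from the tree.  This file proves the
item on the strata that need NO gluing — everything sorry-free, definition-free, and modulo exactly one
hypothesis `hdil`, the REGISTERED DILATION STUB `isKerrShieldedAway_dilate` of the crux
(stmt-FinalStateConjecture-10052, line `null-shell-shadow-collar`; its proof is that line's business and is taken
here verbatim as a hypothesis, not restated as a fact):

* §1 `isKerrShielded_dilate_of`, `homothety_eq_comap_dilate`, `isKerrShielded_homothety_of` — dilation and
  homothety covariance of the shield on `ℝ³` (homothety = dilate re-read along `y ↦ c y`, plus the diffeomorphism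
  covariance `isKerrShielded_comap` of the companion file);
* §2 `flat_burial` — THE RELATIVE BURIAL OF THE FLAT DATUM: for `B` admissible and shielded and `d = (δ, 0)`
  admissible on `ℝ³`, through `d` passes a smooth injective admissible family whose members off `c = 0` are
  shielded.  Construction (blow-up of the background, no PDE): in an `h_B(0)`-orthonormal linear frame `A`
  (`exists_frame`) put `B₁ := A^* B`; for `c ≠ 0` let `F c` be the homothety by `e^{-c₀}` of the dilate of `B₁` by
  `c₀⁻²`, i.e. `(e^{-2c₀} h_{B₁}(c₀² ·), e^{-c₀} c₀² k_{B₁}(c₀² ·))`, and `F 0 := d`.  The two section maps are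
  COMPOSITES of smooth maps on all of `ℝ¹ × ℝ³` (equal to `(δ, 0)` at `c = 0` because `h_{B₁}(0) = δ`), so joint
  smoothness at `c = 0` costs nothing; the marker `c ↦ h_{F c}(0)(e₁, e₁) = e^{-2c₀}` gives injectivity;
  admissibility and shieldedness are the covariances.  `flat_burial_of_kerrShieldedDataExist` is the same from
  the item's hypothesis; `self_burial`: every shielded admissible datum on `ℝ³` buries itself by its exponential
  homothety thread (all members shielded);
* (companion file `…Slice.lean`) `burial_comap` — burials transport along diffeomorphisms `Y ≅ ℝ³`; and
  `trivialData_burial_of_kerrShieldedDataExist` — the conclusion of `ParametricKerrBurial` at the tree's instance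
  `(Minkowski.slice, trivialData)` from `KerrShieldedDataExist` (mod `hdil`).

What this does NOT do: bury a general `d` (the glued stratum) — that is the crux.

References: route file `Theses/SwallowTheDatum.lean` (items 14721, 10052, 10055); Bartnik–Isenberg 2004, §2
(covariance of data under diffeomorphisms and scaling); O'Neill 1983, Ch. 3, Def. 3.9, Prop. 3.59; Christodoulou
1999, p. A24; Hintz 2022 (arXiv:2210.13960), Thm. 1.1 (3) (blow-up normalisation `x̂ ↦ p + ε L x̂`).
-/

-- `Summit.<Summit>.<Problem>` is the tree's mandated summit-side namespace (CONVENTIONS §2); for this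
-- single-conjunct summit the two coincide, so the duplicate is deliberate.
set_option linter.dupNamespace false

noncomputable section

namespace Summit.FinalStateConjecture.FinalStateConjecture.Theorems.SwallowTheDatum.BurialIntoShieldedBackground

open scoped Manifold ContDiff Topology InnerProductSpace
open Bundle Set Function Literature.Geometry.Lorentzian
open Summit.FinalStateConjecture.FinalStateConjecture.Theses.SwallowTheDatum
  (ParametricKerrBurial KerrShieldedDataExist BurialIntoShieldedBackground)
open Summit.FinalStateConjecture.FinalStateConjecture.Theorems.SwallowTheDatum.ParametricKerrBurial
  (IsKerrShielded IsKerrShieldedAway)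
open Summit.FinalStateConjecture.FinalStateConjecture.Theorems.CaptureSuffices.CaptureExportsCensorshipDiagonalSurgery
  (homothety_mem_admissibleVacuumData)

/-! ## §1 Dilation and homothety covariance of the shield (from the registered dilation stub) -/

section Homothety

variable [Kerr.Facts]

/-- A shield is a located shield with the vacuous location radius `ρ = -1`. [folklore] -/
theorem isKerrShieldedAway_neg_one {C : InitialDataSet (𝓡 3) E3} (h : IsKerrShielded E3 C) :
    IsKerrShieldedAway (-1) C := by
  obtain ⟨M, a, r₁, hM, T, φ, ψ, ν, hrest⟩ := h
  exact ⟨M, a, r₁, hM, T, φ, ψ, ν, fun z ↦ by linarith [norm_nonneg (φ z)], hrest⟩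

/-- **Dilation covariance of the shield**, from the DILATION STUB of the crux (`isKerrShieldedAway_dilate`,
registered on stmt-FinalStateConjecture-10052 by the line `null-shell-shadow-collar`, taken here as the
hypothesis `hdil` verbatim): if `C` is Kerr-shielded then so is its physical dilate `C.dilate l`
(`h'(y) = h(y/l)`, `k'(y) = l⁻¹ k(y/l)`; shield parameters `(lM, la, l r₁)`). [folklore] -/
theorem isKerrShielded_dilate_of
    (hdil : ∀ (l ρ : ℝ) (C D : InitialDataSet (𝓡 3) E3), 0 < l →
      (∀ x v w : E3, D.h.inner x v w = C.h.inner (l⁻¹ • x) v w) →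
      (∀ x v w : E3, D.k x v w = l⁻¹ * C.k (l⁻¹ • x) v w) →
      IsKerrShieldedAway ρ C → IsKerrShieldedAway (l * ρ) D)
    {C : InitialDataSet (𝓡 3) E3} (hC : IsKerrShielded E3 C) (l : ℝ) (hl : 0 < l) :
    IsKerrShielded E3 (C.dilate l hl) :=
  (hdil l (-1) C (C.dilate l hl) hl (C.dilate_h_inner l hl) (C.dilate_k l hl)
    (isKerrShieldedAway_neg_one hC)).isKerrShielded

omit [Kerr.Facts] in
/-- **A homothety of data on `ℝ³` is a dilate re-read along the inverse zoom**:
`(c² h, c k) = (y ↦ c y)^* (C.dilate c)`. [folklore] -/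
theorem homothety_eq_comap_dilate (C : InitialDataSet (𝓡 3) E3) (c : ℝ) (hc : 0 < c) :
    C.homothety c hc =
      (C.dilate c hc).comap ((LinearEquiv.smulOfNeZero ℝ E3 c hc.ne').toContinuousLinearEquiv)
        (contMDiff_linear _) (injective_mfderiv_linear _) := by
  have hAy : ∀ y : E3, (LinearEquiv.smulOfNeZero ℝ E3 c hc.ne').toContinuousLinearEquiv y = c • y :=
    fun y ↦ rfl
  -- componentwise, with `E3`-typed vectors (the tangent spaces of `E3` are `E3`)
  have hh : ∀ y v w : E3, (C.homothety c hc).coordH y v w =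
      ((C.dilate c hc).comap ((LinearEquiv.smulOfNeZero ℝ E3 c hc.ne').toContinuousLinearEquiv)
        (contMDiff_linear _) (injective_mfderiv_linear _)).coordH y v w := by
    intro y v w
    rw [coordH_comap_linear, hAy, hAy, hAy, InitialDataSet.coordH_dilate, inv_smul_smul₀ hc.ne',
      map_smul, map_smul, InitialDataSet.coordH_apply, InitialDataSet.homothety_h_inner,
      ← InitialDataSet.coordH_apply]
    simp only [FunLike.coe_smul, Pi.smul_apply, smul_eq_mul]
    ring
  have hk : ∀ y v w : E3, (C.homothety c hc).coordK y v w =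
      ((C.dilate c hc).comap ((LinearEquiv.smulOfNeZero ℝ E3 c hc.ne').toContinuousLinearEquiv)
        (contMDiff_linear _) (injective_mfderiv_linear _)).coordK y v w := by
    intro y v w
    rw [coordK_comap_linear, hAy, hAy, hAy, InitialDataSet.coordK_dilate, inv_smul_smul₀ hc.ne',
      FunLike.coe_smul, Pi.smul_apply, map_smul, map_smul, InitialDataSet.coordK_apply,
      InitialDataSet.homothety_k, ← InitialDataSet.coordK_apply]
    simp only [FunLike.coe_smul, Pi.smul_apply, smul_eq_mul]
    field_simp
  exact InitialDataSet.ext' (fun y v w ↦ hh y v w) (fun y v w ↦ hk y v w)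

/-- **Homothety covariance of the shield** on `ℝ³` (from the dilation stub and diffeomorphism covariance):
if `C` is Kerr-shielded then so is `(c² h, c k)`, `c > 0`. [folklore] -/
theorem isKerrShielded_homothety_of
    (hdil : ∀ (l ρ : ℝ) (C D : InitialDataSet (𝓡 3) E3), 0 < l →
      (∀ x v w : E3, D.h.inner x v w = C.h.inner (l⁻¹ • x) v w) →
      (∀ x v w : E3, D.k x v w = l⁻¹ * C.k (l⁻¹ • x) v w) →
      IsKerrShieldedAway ρ C → IsKerrShieldedAway (l * ρ) D)
    {C : InitialDataSet (𝓡 3) E3} (hC : IsKerrShielded E3 C) (c : ℝ) (hc : 0 < c) :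
    IsKerrShielded E3 (C.homothety c hc) := by
  rw [homothety_eq_comap_dilate C c hc]
  exact isKerrShielded_comap (LinearEquiv.smulOfNeZero ℝ E3 c hc.ne').toContinuousLinearEquiv.toDiffeomorph
    (contMDiff_linear _) (injective_mfderiv_linear _) (isKerrShielded_dilate_of hdil hC c hc)

end Homothety

/-! ## §2 The relative burial of the flat datum; shielded data bury themselves -/

section Main

variable [Kerr.Facts]

omit [Kerr.Facts] in
/-- A parameter `c ∈ ℝ¹` vanishes iff its coordinate does. [folklore] -/
theorem eq_zero_iff_apply (c : EuclideanSpace ℝ (Fin 1)) : c = 0 ↔ c 0 = 0 := by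
  constructor
  · rintro rfl
    rfl
  · intro h
    ext i
    rw [Subsingleton.elim i 0, h]
    rfl

/-- **THE RELATIVE BURIAL OF THE FLAT DATUM.**  Let `B` be an admissible Kerr-shielded datum on `ℝ³` (a
witness of `KerrShieldedDataExist`) and `d` an admissible datum on `ℝ³` which is the flat Euclidean datum
`(δ, 0)`.  Then through `d` passes a smooth injective admissible one-parameter family `F` whose members
`F c`, `c ≠ 0`, are Kerr-shielded — the conclusion of `ParametricKerrBurial` at `(ℝ³, d)`.  CONSTRUCTION
(blow-up of the background): in an `h_B(0)`-orthonormal linear frame `A` (`exists_frame`) put `B₁ := A^* B`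
(admissible, shielded, `h_{B₁}(0) = δ`), and set, for `c ≠ 0`,
`F c := (e^{-2c₀} h_{B₁}(c₀² ·), e^{-c₀} c₀² k_{B₁}(c₀² ·))`, the homothety by `e^{-c₀}` of the dilate of `B₁`
by `c₀⁻²`; and `F 0 := d`.  Every member is a homothety of a dilate of a linear pullback of `B`, hence
admissible (`comap`/`dilate`/`homothety_mem_admissibleVacuumData`) and shielded (diffeomorphism, dilation
and homothety covariance of the shield); the two section maps are the COMPOSITES
`(c, y) ↦ e^{-2c₀} h_{B₁}(c₀² y)`, `(c, y) ↦ e^{-c₀} c₀² k_{B₁}(c₀² y)` of smooth maps, equal AT `c = 0` to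
`(δ, 0) = d` — so `F` is jointly `C^∞` on all of `ℝ¹ × ℝ³` with no decay estimate whatsoever; and the marker
`c ↦ h_{F c}(0)(e₁, e₁) = e^{-2c₀}` is injective.  (The dilation covariance of the shield is the registered
stub `isKerrShieldedAway_dilate` of crux 10052, hypothesis `hdil`.)  This is the item
`BurialIntoShieldedBackground` restricted to the flat datum on `ℝ³`: the black hole as an eraser needs no
gluing when there is nothing to erase. [folklore] -/
theorem flat_burial
    (hdil : ∀ (l ρ : ℝ) (C D : InitialDataSet (𝓡 3) E3), 0 < l →
      (∀ x v w : E3, D.h.inner x v w = C.h.inner (l⁻¹ • x) v w) →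
      (∀ x v w : E3, D.k x v w = l⁻¹ * C.k (l⁻¹ • x) v w) →
      IsKerrShieldedAway ρ C → IsKerrShieldedAway (l * ρ) D)
    {B : InitialDataSet (𝓡 3) E3} (hB : B ∈ admissibleVacuumData E3) (hBs : IsKerrShielded E3 B)
    {d : InitialDataSet (𝓡 3) E3} (hd : d ∈ admissibleVacuumData E3)
    (hdh : ∀ y v w : E3, d.h.inner y v w = ⟪v, w⟫_ℝ) (hdk : ∀ y v w : E3, d.k y v w = 0) :
    ∃ F : EuclideanSpace ℝ (Fin 1) → InitialDataSet (𝓡 3) E3,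
      InitialDataSet.IsSmoothDataFamily 1 F ∧ F 0 = d ∧ Injective F ∧
        (∀ c, F c ∈ admissibleVacuumData E3) ∧ ∀ c ≠ 0, IsKerrShielded E3 (F c) := by
  classical
  -- Step 1: an `h_B(0)`-orthonormal frame; the background in that frame has `h(0) = δ`
  obtain ⟨A, hA⟩ := exists_frame (B.h.inner 0) (fun v w ↦ B.h.symm 0 v w) (fun v hv ↦ B.h.pos 0 v hv)
  set B₁ := B.comap A (contMDiff_linear A) (injective_mfderiv_linear A) with hB₁
  obtain ⟨hB₁adm, hB₁s⟩ := comap_linear_mem_and_shielded A hB hBs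
  have hB₁0 : ∀ v w, B₁.coordH 0 v w = ⟪v, w⟫_ℝ := fun v w ↦ by
    rw [hB₁, coordH_comap_linear, map_zero]
    exact hA v w
  -- Step 2: the family
  set μ : EuclideanSpace ℝ (Fin 1) → ℝ := fun c ↦ Real.exp (-(c 0)) with hμ
  have h00 : (0 : EuclideanSpace ℝ (Fin 1)) 0 = 0 := rfl
  have hμ0 : μ 0 = 1 := by simp [hμ]
  set F : EuclideanSpace ℝ (Fin 1) → InitialDataSet (𝓡 3) E3 := fun c ↦
    if c = 0 then d else (B₁.dilateFamily ((c 0) ^ 2)⁻¹).homothety (μ c) (Real.exp_pos _) with hF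
  have hlpos : ∀ c : EuclideanSpace ℝ (Fin 1), c ≠ 0 → 0 < ((c 0) ^ 2)⁻¹ := fun c hc ↦
    inv_pos.2 (pow_pos (abs_pos.2 fun h0 ↦ hc ((eq_zero_iff_apply c).2 h0)) 2 |>.trans_eq (by simp))
  have hF0 : F 0 = d := by simp [hF]
  have hFne : ∀ c : EuclideanSpace ℝ (Fin 1), (hc : c ≠ 0) →
      F c = (B₁.dilate ((c 0) ^ 2)⁻¹ (hlpos c hc)).homothety (μ c) (Real.exp_pos _) := fun c hc ↦ by
    simp only [hF, if_neg hc, B₁.dilateFamily_of_pos (hlpos c hc)]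
  -- pointwise formulas for the sections, valid for ALL `c`
  have hFh : ∀ (c : EuclideanSpace ℝ (Fin 1)) (x v w : E3),
      (F c).coordH x v w = μ c ^ 2 * B₁.coordH ((c 0) ^ 2 • x) v w := by
    intro c x v w
    by_cases hc : c = 0
    · subst hc
      rw [InitialDataSet.coordH_apply, hF0, hdh, h00, hμ0, zero_pow two_ne_zero, zero_smul, hB₁0]
      ring
    · rw [InitialDataSet.coordH_apply, hFne c hc, InitialDataSet.homothety_h_inner,
        B₁.dilate_h_inner _ (hlpos c hc), inv_inv]
      rfl
  have hFk : ∀ (c : EuclideanSpace ℝ (Fin 1)) (x v w : E3),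
      (F c).coordK x v w = (μ c * (c 0) ^ 2) * B₁.coordK ((c 0) ^ 2 • x) v w := by
    intro c x v w
    by_cases hc : c = 0
    · subst hc
      rw [InitialDataSet.coordK_apply, hF0, hdk, h00]
      simp
    · rw [InitialDataSet.coordK_apply, hFne c hc, InitialDataSet.homothety_k,
        B₁.dilate_k _ (hlpos c hc), inv_inv, InitialDataSet.coordK_apply]
      ring
  refine ⟨F, ?_, hF0, ?_, ?_, ?_⟩
  · -- Step 3: joint smoothness — the sections are composites of smooth maps
    have hc0 : ContDiff ℝ ∞ (fun c : EuclideanSpace ℝ (Fin 1) ↦ c 0) := contDiff_piLp_apply (p := 2)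
    have hproj : ContMDiff (𝓘(ℝ, EuclideanSpace ℝ (Fin 1)).prod (𝓡 3)) 𝓘(ℝ, ℝ) ∞
        (fun q : EuclideanSpace ℝ (Fin 1) × E3 ↦ q.1 0) :=
      hc0.contMDiff.comp contMDiff_fst
    have hμs : ContMDiff (𝓘(ℝ, EuclideanSpace ℝ (Fin 1)).prod (𝓡 3)) 𝓘(ℝ, ℝ) ∞
        (fun q : EuclideanSpace ℝ (Fin 1) × E3 ↦ μ q.1) :=
      Real.contDiff_exp.contMDiff.comp hproj.neg
    have hsq : ContMDiff (𝓘(ℝ, EuclideanSpace ℝ (Fin 1)).prod (𝓡 3)) 𝓘(ℝ, ℝ) ∞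
        (fun q : EuclideanSpace ℝ (Fin 1) × E3 ↦ (q.1 0) ^ 2) := hproj.pow 2
    have hzoom : ContMDiff (𝓘(ℝ, EuclideanSpace ℝ (Fin 1)).prod (𝓡 3)) (𝓡 3) ∞
        (fun q : EuclideanSpace ℝ (Fin 1) × E3 ↦ (q.1 0) ^ 2 • q.2) := hsq.smul contMDiff_snd
    have hH : ContMDiff (𝓘(ℝ, EuclideanSpace ℝ (Fin 1)).prod (𝓡 3)) 𝓘(ℝ, E3 →L[ℝ] E3 →L[ℝ] ℝ) ∞
        (fun q : EuclideanSpace ℝ (Fin 1) × E3 ↦ (μ q.1 ^ 2) • B₁.coordH ((q.1 0) ^ 2 • q.2)) :=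
      (hμs.pow 2).smul (B₁.contMDiff_coordH.comp hzoom)
    have hK : ContMDiff (𝓘(ℝ, EuclideanSpace ℝ (Fin 1)).prod (𝓡 3)) 𝓘(ℝ, E3 →L[ℝ] E3 →L[ℝ] ℝ) ∞
        (fun q : EuclideanSpace ℝ (Fin 1) × E3 ↦ (μ q.1 * (q.1 0) ^ 2) • B₁.coordK ((q.1 0) ^ 2 • q.2)) :=
      (hμs.mul hsq).smul (B₁.contMDiff_coordK.comp hzoom)
    refine ⟨fun q ↦ ?_, fun q ↦ ?_⟩
    · have heq : (fun p : EuclideanSpace ℝ (Fin 1) × E3 ↦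
          TotalSpace.mk' (F := E3 →L[ℝ] E3 →L[ℝ] ℝ)
            (E := fun x : E3 ↦ TangentSpace (𝓡 3) x →L[ℝ] TangentSpace (𝓡 3) x →L[ℝ] ℝ) p.2
            ((F p.1).h.inner p.2)) =
          fun p ↦ TotalSpace.mk' (F := E3 →L[ℝ] E3 →L[ℝ] ℝ)
            (E := fun x : E3 ↦ TangentSpace (𝓡 3) x →L[ℝ] TangentSpace (𝓡 3) x →L[ℝ] ℝ) p.2
            ((μ p.1 ^ 2) • B₁.coordH ((p.1 0) ^ 2 • p.2)) := by
        funext p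
        congr 1
        ext v w
        rw [← InitialDataSet.coordH_apply, hFh]
        rfl
      rw [heq]
      exact contMDiffAt_bilinE3_iff.2 ⟨contMDiffAt_snd, hH q⟩
    · have heq : (fun p : EuclideanSpace ℝ (Fin 1) × E3 ↦
          TotalSpace.mk' (F := E3 →L[ℝ] E3 →L[ℝ] ℝ)
            (E := fun x : E3 ↦ TangentSpace (𝓡 3) x →L[ℝ] TangentSpace (𝓡 3) x →L[ℝ] ℝ) p.2
            ((F p.1).k p.2)) =
          fun p ↦ TotalSpace.mk' (F := E3 →L[ℝ] E3 →L[ℝ] ℝ)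
            (E := fun x : E3 ↦ TangentSpace (𝓡 3) x →L[ℝ] TangentSpace (𝓡 3) x →L[ℝ] ℝ) p.2
            ((μ p.1 * (p.1 0) ^ 2) • B₁.coordK ((p.1 0) ^ 2 • p.2)) := by
        funext p
        congr 1
        ext v w
        rw [← InitialDataSet.coordK_apply, hFk]
        rfl
      rw [heq]
      exact contMDiffAt_bilinE3_iff.2 ⟨contMDiffAt_snd, hK q⟩
  · -- Step 4: injectivity, read off the marker `h_{F c}(0)(e₁, e₁) = e^{-2c₀}`
    intro c c' hcc'
    set v₀ : E3 := EuclideanSpace.single (0 : Fin 3) (1 : ℝ) with hv₀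
    have hv₀n : ‖v₀‖ = 1 := by simp [hv₀]
    have hm : ∀ c, (F c).coordH 0 v₀ v₀ = μ c ^ 2 := fun c ↦ by
      rw [hFh, smul_zero, hB₁0, real_inner_self_eq_norm_sq, hv₀n]
      ring
    have h1 : μ c ^ 2 = μ c' ^ 2 := by rw [← hm, ← hm, hcc']
    have h2 : μ c = μ c' := (pow_left_inj₀ (Real.exp_pos _).le (Real.exp_pos _).le two_ne_zero).1 h1
    have h3 : c 0 = c' 0 := by simpa [hμ] using h2
    ext i
    rw [Subsingleton.elim i 0, h3]
  · -- Step 5: admissibility of every member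
    intro c
    by_cases hc : c = 0
    · rw [hc, hF0]
      exact hd
    · rw [hFne c hc]
      exact homothety_mem_admissibleVacuumData (B₁.dilate_mem_admissibleVacuumData _ (hlpos c hc) hB₁adm) _
  · -- Step 6: the members off `c = 0` are shielded
    intro c hc
    rw [hFne c hc]
    exact isKerrShielded_homothety_of hdil (isKerrShielded_dilate_of hdil hB₁s _ (hlpos c hc)) _ _

/-- **The item at the flat datum.**  `KerrShieldedDataExist` (one admissible Kerr-shielded datum on `ℝ³`)
implies the conclusion of `ParametricKerrBurial` for every admissible flat Euclidean datum `(δ, 0)` on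
`ℝ³` — modulo the registered dilation stub `isKerrShieldedAway_dilate` of the crux (hypothesis `hdil`).
[folklore] -/
theorem flat_burial_of_kerrShieldedDataExist
    (hdil : ∀ (l ρ : ℝ) (C D : InitialDataSet (𝓡 3) E3), 0 < l →
      (∀ x v w : E3, D.h.inner x v w = C.h.inner (l⁻¹ • x) v w) →
      (∀ x v w : E3, D.k x v w = l⁻¹ * C.k (l⁻¹ • x) v w) →
      IsKerrShieldedAway ρ C → IsKerrShieldedAway (l * ρ) D)
    (hK : KerrShieldedDataExist) {d : InitialDataSet (𝓡 3) E3} (hd : d ∈ admissibleVacuumData E3)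
    (hdh : ∀ y v w : E3, d.h.inner y v w = ⟪v, w⟫_ℝ) (hdk : ∀ y v w : E3, d.k y v w = 0) :
    ∃ F : EuclideanSpace ℝ (Fin 1) → InitialDataSet (𝓡 3) E3,
      InitialDataSet.IsSmoothDataFamily 1 F ∧ F 0 = d ∧ Injective F ∧
        (∀ c, F c ∈ admissibleVacuumData E3) ∧ ∀ c ≠ 0, IsKerrShielded E3 (F c) := by
  obtain ⟨B, hB, hBs⟩ := hK
  exact flat_burial hdil hB hBs hd hdh hdk

/-- **Every Kerr-shielded admissible datum on `ℝ³` buries itself**: the exponential homothety thread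
`c ↦ (e^{2c₀} h_B, e^{c₀} k_B)` through `B` is a smooth injective admissible family ALL of whose members are
Kerr-shielded (homothety covariance of the shield, modulo the dilation stub `hdil`) — the conclusion of
`ParametricKerrBurial` at `(ℝ³, B)` with the guard `c ≠ 0` idle.  (Thread: `isSmoothDataFamily_homothety_exp`,
`homothety_injective`, `homothety_mem_admissibleVacuumData` of the `CaptureSuffices` dilation-thread file.)
[folklore] -/
theorem self_burial
    (hdil : ∀ (l ρ : ℝ) (C D : InitialDataSet (𝓡 3) E3), 0 < l →
      (∀ x v w : E3, D.h.inner x v w = C.h.inner (l⁻¹ • x) v w) →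
      (∀ x v w : E3, D.k x v w = l⁻¹ * C.k (l⁻¹ • x) v w) →
      IsKerrShieldedAway ρ C → IsKerrShieldedAway (l * ρ) D)
    {B : InitialDataSet (𝓡 3) E3} (hB : B ∈ admissibleVacuumData E3) (hBs : IsKerrShielded E3 B) :
    ∃ F : EuclideanSpace ℝ (Fin 1) → InitialDataSet (𝓡 3) E3,
      InitialDataSet.IsSmoothDataFamily 1 F ∧ F 0 = B ∧ Injective F ∧
        (∀ c, F c ∈ admissibleVacuumData E3) ∧ ∀ c, IsKerrShielded E3 (F c) := by
  refine ⟨fun c ↦ B.homothety (Real.exp (c 0)) (Real.exp_pos _),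
    CaptureSuffices.CaptureExportsCensorshipDiagonalSurgery.isSmoothDataFamily_homothety_exp B, ?_, ?_,
    fun c ↦ homothety_mem_admissibleVacuumData hB _,
    fun c ↦ isKerrShielded_homothety_of hdil hBs _ _⟩
  · show B.homothety (Real.exp ((0 : EuclideanSpace ℝ (Fin 1)) 0)) (Real.exp_pos _) = B
    have h1 : Real.exp ((0 : EuclideanSpace ℝ (Fin 1)) 0) = 1 := by
      rw [show ((0 : EuclideanSpace ℝ (Fin 1)) 0) = (0 : ℝ) from rfl, Real.exp_zero]
    rw [CaptureSuffices.CaptureExportsCensorshipDiagonalSurgery.homothety_congr B (Real.exp_pos _) one_pos h1]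
    exact B.homothety_one
  · intro c c' hcc'
    have h1 : Real.exp (c 0) = Real.exp (c' 0) :=
      CaptureSuffices.CaptureExportsCensorshipDiagonalSurgery.homothety_injective B (Real.exp_pos _)
        (Real.exp_pos _) hcc'
    ext i
    rw [Subsingleton.elim i 0, Real.exp_injective h1]

end Main


end Summit.FinalStateConjecture.FinalStateConjecture.Theorems.SwallowTheDatum.BurialIntoShieldedBackground

end
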